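import Literature.AnabelianGeometry.SemiGraphs.TemperedReconstructionEdgeMapProofs
import Literature.AnabelianGeometry.SemiGraphs.TemperedEdgeLikeDistinctProofs
import Literature.AnabelianGeometry.SemiGraphs.TemperedFunctorialityProofs
import HarnessLib

/-!
# [SemiAnbd] Cor. 3.9, step (b), anabelioid level — part 1: hosts, branches and the 2-cell at a branch

Mochizuki, *Semi-graphs of anabelioids*, Publ. RIMS **42** (2006) [MochizukiSemiAnbd2006], Cor. 3.9,
proof, PRIMS pp. 267–268 (kurims pp. 42–43): "any quasi-geometric `φ : B^temp(G) → B^temp(H)`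
determines a map from the vertices of `G` to the vertices of `H` … a map from the edges of `G` to the
edges of `H` which is compatible with the map obtained above on vertices … we conclude that `φ` arises
from a morphism of graphs of anabelioids which [again by Theorem 3.7, (iii), (iv)] is manifestly unique
and locally open" [cite: MochizukiSemiAnbd2006, Cor 3.9 pp.42-43].

PROOF-ONLY (no definitions; cell abc-iut, layer L3, sub-node «R2 remainder (b2)» of the Cor. 3.9
reduction `TemperedReconstructionReductions.lean`, abc-iut-L3-lead 2026-08-25T23:32:39Z (d)).  This
part supplies, from the typed Theorem 3.7 (i) `VerticialInjective`, (ii) `VerticialDistinct`, (iii)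
`CompactInVerticial` as HYPOTHESES (reduction style, as in abc-iut-L3-t11's
`TemperedEdgeLikeDistinctProofs.lean`, whose toolkit is used throughout):
* lemmas: a continuous homomorphism whose range lies in the range of an injective continuous
  homomorphism from a compact group lifts through it (`exists_lift_of_range_le`); edge homomorphisms are
  injective (`injective_of_isEdgeHom_of_edge`); conjugacy of verticial / edge homomorphisms (Prop. 3.2);
* `exists_branch_of_host` — THE HOST SINGLES OUT A BRANCH: for an edge homomorphism `χ` of `H` at a
  closed edge `e'`, a nontrivial compact `M ⊆ range χ` and a verticial `W ⊇ M` at `w`, the subgroup `W`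
  is the host of `range χ` through one of the two branches `b'` of `e'`, `b'` abuts to `w`, and
  `Ψ_w ∘ b'_*` is conjugate to `χ` by `k` with `W = k⁻¹·Ψ_w(Π_w)·k` (Thm 3.7 (iii) on `M`; the two hosts
  of `range χ` are distinct by total estrangement; hosts at distinct vertices differ by Thm 3.7 (ii));
* `exists_target_branch_comm` — THE 2-CELL AT A BRANCH: for a branch `b` of `G` at `v`, lifts
  `hV : Π_v → Π_w`, `hE : Π_e → Π_{e'}` of `φ ∘ ψ_v`, `φ ∘ ψ_e` through verticial / edge homomorphisms of
  `H`, there are a branch `b'` of `e'` at `w` and `γ ∈ Π_w` with `hV ∘ b_* = γ_γ ∘ b'_* ∘ hE` — the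
  conjugator lands INSIDE `Π_w` by commensurable terminality (Thm 3.7 (ii), clause 2) once `b'` is the
  branch singled out by the host of the image of the edge group.
Part 2 (`TemperedReconstructionR2bHomProofs.lean`) assembles the locally open morphism `G → H`.
READING: the branch `b'` is FORCED by `φ` (in the loop case `w₁ = w₂` the other branch admits no
2-cell); this is the content the literal Def. 3.8 does not control at the level of branch BIJECTIONS —
cf. findings W4d083-F1 / t2g2-F1 (the "fold") and the compatible reading `IsCompatiblyQuasiGeometric`
(abc-iut-L3-t2).  Nothing here takes a side on [IUTchIII] Cor. 3.12; typed ≠ discharged.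
-/

open CategoryTheory Topology

namespace Literature.AnabelianGeometry.SemiGraphs

namespace ProfiniteSemiGraph

universe u

/-! ### Generic lemmas -/

/-- The lifting step of Cor. 3.9's "`φ` induces morphisms `G_v → H_w`" ([SemiAnbd] p. 43 l. 10–12): a
continuous homomorphism whose range lies in the range of a continuous INJECTIVE homomorphism from a
compact group into a Hausdorff group lifts continuously through it (the target is a closed embedding).
[cite: MochizukiSemiAnbd2006, Cor 3.9 p.43] -/
theorem exists_lift_of_range_le {A B C : Type*} [Group A] [TopologicalSpace A] [Group B]
    [TopologicalSpace B] [CompactSpace B] [Group C] [TopologicalSpace C] [T2Space C]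
    (α : A →ₜ* C) (β : B →ₜ* C) (hβ : Function.Injective β)
    (h : α.toMonoidHom.range ≤ β.toMonoidHom.range) :
    ∃ γ : A →ₜ* B, ∀ a, β (γ a) = α a := by
  have hex : ∀ a, ∃ b, β b = α a := fun a => h ⟨a, rfl⟩
  choose γ₀ hγ₀ using hex
  have hmul : ∀ x y, γ₀ (x * y) = γ₀ x * γ₀ y := by
    intro x y
    apply hβ
    rw [map_mul, hγ₀, hγ₀, hγ₀, map_mul]
  have hemb : IsClosedEmbedding β := β.continuous.isClosedEmbedding hβ
  have hcont : Continuous γ₀ := by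
    rw [hemb.isEmbedding.continuous_iff]
    have : (β : B → C) ∘ γ₀ = α := funext hγ₀
    rw [this]
    exact α.continuous
  exact ⟨⟨MonoidHom.mk' γ₀ hmul, hcont⟩, hγ₀⟩

variable {𝒢 ℋ : ProfiniteSemiGraph.{u}}

/-! ### Verticial and edge homomorphisms: existence, conjugacy, injectivity -/

/-- Under Thm 3.7 (i) every vertex carries a verticial homomorphism.
[cite: MochizukiSemiAnbd2006, Thm 3.7(i) p.40] -/
theorem exists_isVerticialHom_of_thm37i (h37i : VerticialInjective.{u}) (h𝒢 : 𝒢.Thm37Hypotheses)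
    (c : TemperedPiChart 𝒢) (v : 𝒢.graph.Vertex) : ∃ ψ : 𝒢.Gv v →ₜ* c.G, IsVerticialHom c v ψ := by
  obtain ⟨⟨_, ψ, hψ, -⟩, -⟩ := h37i 𝒢 h𝒢 c v
  exact ⟨ψ, hψ⟩

/-- Two verticial homomorphisms at the same vertex are conjugate (Prop. 3.2).
[cite: MochizukiSemiAnbd2006, Prop 3.2 p.35] -/
theorem exists_conj_of_isVerticialHom (c : TemperedPiChart 𝒢) {v : 𝒢.graph.Vertex}
    (φ ψ : 𝒢.Gv v →ₜ* c.G) (hφ : IsVerticialHom c v φ) (hψ : IsVerticialHom c v ψ) :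
    ∃ g : c.G, ∀ x, g * φ x * g⁻¹ = ψ x := by
  obtain ⟨e⟩ := hφ
  obtain ⟨e'⟩ := hψ
  obtain ⟨g, hg, -⟩ := BTemp.exists_conj_of_natTrans c.isTempered φ ψ (e.symm ≪≫ e').hom
  exact ⟨g, hg⟩

/-- Two edge homomorphisms at the same edge are conjugate (Prop. 3.2).
[cite: MochizukiSemiAnbd2006, Prop 3.2 p.35] -/
theorem exists_conj_of_isEdgeHom (c : TemperedPiChart 𝒢) {e : 𝒢.graph.Edge}
    (φ ψ : 𝒢.Ge e →ₜ* c.G) (hφ : IsEdgeHom c e φ) (hψ : IsEdgeHom c e ψ) :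
    ∃ g : c.G, ∀ x, g * φ x * g⁻¹ = ψ x := by
  obtain ⟨i⟩ := hφ
  obtain ⟨i'⟩ := hψ
  obtain ⟨g, hg, -⟩ := BTemp.exists_conj_of_natTrans c.isTempered φ ψ (i.symm ≪≫ i').hom
  exact ⟨g, hg⟩

/-- An edge homomorphism at `edgeOf b` is conjugate to `ψ_v ∘ b_*` for a verticial `ψ_v` at the
vertex of `b`. [cite: MochizukiSemiAnbd2006, Thm 3.7(iii) p.41] -/
theorem exists_conj_comp_brHom (c : TemperedPiChart 𝒢) {b : 𝒢.graph.Branch} {v : 𝒢.graph.Vertex}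
    (h : 𝒢.graph.abuts b = some v) (ψv : 𝒢.Gv v →ₜ* c.G) (hψv : IsVerticialHom c v ψv)
    (χ : 𝒢.Ge (𝒢.graph.edgeOf b) →ₜ* c.G) (hχ : IsEdgeHom c (𝒢.graph.edgeOf b) χ) :
    ∃ g : c.G, ∀ x, g * χ x * g⁻¹ = ψv (𝒢.brHom b v h x) := by
  have hcomp : IsEdgeHom c (𝒢.graph.edgeOf b) (ψv.comp (𝒢.brHom b v h)) :=
    isEdgeHom_comp_brHom c h hψv
  obtain ⟨g, hg⟩ := exists_conj_of_isEdgeHom c χ (ψv.comp (𝒢.brHom b v h)) hχ hcomp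
  exact ⟨g, fun x => by simpa using hg x⟩

/-- Under the hypotheses of Cor. 3.9 and Thm 3.7 (i), every edge carries an INJECTIVE edge
homomorphism (`ψ_v ∘ b_*` for an abutting branch `b`). [cite: MochizukiSemiAnbd2006, Cor 3.9 p.42] -/
theorem exists_isEdgeHom_injective_of_edge (h37i : VerticialInjective.{u}) (h𝒢 : Cor39Hypotheses 𝒢)
    (c : TemperedPiChart 𝒢) (e : 𝒢.graph.Edge) :
    ∃ ψ : 𝒢.Ge e →ₜ* c.G, IsEdgeHom c e ψ ∧ Function.Injective ψ := by
  obtain ⟨b, -, -, hbe, -, -⟩ := 𝒢.graph.two_branches e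
  obtain ⟨v, hv⟩ := Option.isSome_iff_exists.mp (h𝒢.isGraph.abuts_isSome b)
  subst hbe
  obtain ⟨⟨_, ψv, hψv, rfl⟩, hinj⟩ := h37i 𝒢 h𝒢.thm37Hypotheses c v
  exact ⟨ψv.comp (𝒢.brHom b v hv), isEdgeHom_comp_brHom c hv hψv,
    (hinj ψv hψv).comp (h𝒢.isOfInjectiveType b v hv)⟩

/-- Hence EVERY edge homomorphism is injective (it is conjugate to an injective one).
[cite: MochizukiSemiAnbd2006, Cor 3.9 p.42] -/
theorem injective_of_isEdgeHom_of_edge (h37i : VerticialInjective.{u}) (h𝒢 : Cor39Hypotheses 𝒢)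
    (c : TemperedPiChart 𝒢) {e : 𝒢.graph.Edge} (χ : 𝒢.Ge e →ₜ* c.G) (hχ : IsEdgeHom c e χ) :
    Function.Injective χ := by
  obtain ⟨ψ, hψ, hinj⟩ := exists_isEdgeHom_injective_of_edge h37i h𝒢 c e
  obtain ⟨g, hg⟩ := exists_conj_of_isEdgeHom c ψ χ hψ hχ
  intro x y hxy
  apply hinj
  have := congrArg (fun z => g⁻¹ * z * g) (show g * ψ x * g⁻¹ = g * ψ y * g⁻¹ by rw [hg, hg, hxy])
  simpa [mul_assoc] using this

/-! ### Branch homomorphisms re-indexed along an equation of edges -/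

/-- `exists_conj_comp_brHom` for an edge homomorphism indexed by an edge `f = edgeOf b`.
[cite: MochizukiSemiAnbd2006, Thm 3.7(iii) p.41] -/
theorem exists_conj_comp_brHomAt (c : TemperedPiChart 𝒢) {b : 𝒢.graph.Branch}
    {v : 𝒢.graph.Vertex} (h : 𝒢.graph.abuts b = some v) (ψv : 𝒢.Gv v →ₜ* c.G)
    (hψv : IsVerticialHom c v ψv) {f : 𝒢.graph.Edge} (q : 𝒢.graph.edgeOf b = f)
    (χ : 𝒢.Ge f →ₜ* c.G) (hχ : IsEdgeHom c f χ) :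
    ∃ g : c.G, ∀ x, g * χ x * g⁻¹ = ψv (𝒢.brHomAt b v h f q x) := by
  subst q
  exact exists_conj_comp_brHom c h ψv hψv χ hχ

/-- The re-indexed branch homomorphism lands in the branch subgroup.
[cite: MochizukiSemiAnbd2006, §2 p.23] -/
theorem brHomAt_mem_branchSubgroup {b : 𝒢.graph.Branch} {v : 𝒢.graph.Vertex}
    (h : 𝒢.graph.abuts b = some v) {f : 𝒢.graph.Edge} (q : 𝒢.graph.edgeOf b = f) (y : 𝒢.Ge f) :
    𝒢.brHomAt b v h f q y ∈ 𝒢.branchSubgroup b v h := by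
  subst q
  exact ⟨y, rfl⟩

/-! ### The host of the image of an edge group singles out a branch (Thm 3.7 (ii), (iii)) -/

/-- **Core step of [SemiAnbd] Cor. 3.9, p. 267 «compatible with the map obtained above on vertices»,
made precise.** Let `χ` be an edge homomorphism of `H` at a (closed) edge `e'`, `M ≠ 1` a compact
subgroup of its range, and `W` a verticial subgroup at `w` containing `M`. Then `W` is the host of
`range χ` through one of the two branches `b'` of `e'`, this branch abuts to `w`, and the verticial
homomorphism `Ψ_w ∘ b'_*` is conjugate to `χ` by an element `k` with `W = k⁻¹·Ψ_w(Π_w)·k`. (The two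
hosts of `range χ` through the two branches are distinct by total estrangement; `M` has at most two
hosts by Thm 3.7 (iii); hosts at distinct vertices are distinct by Thm 3.7 (ii).)
[cite: MochizukiSemiAnbd2006, Cor 3.9 p.42] -/
theorem exists_branch_of_host (h37i : VerticialInjective.{u}) (h37ii : VerticialDistinct.{u})
    (h37iii : CompactInVerticial.{u}) (hℋ : Cor39Hypotheses ℋ) (c : TemperedPiChart ℋ)
    (Ψ : ∀ w : ℋ.graph.Vertex, ℋ.Gv w →ₜ* c.G) (hΨ : ∀ w, IsVerticialHom c w (Ψ w))
    {e' : ℋ.graph.Edge} (χ : ℋ.Ge e' →ₜ* c.G) (hχ : IsEdgeHom c e' χ)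
    {M : Subgroup c.G} (hME : M ≤ χ.toMonoidHom.range) (hMc : IsCompact (M : Set c.G))
    (hMne : M ≠ ⊥) {w : ℋ.graph.Vertex} {W : Subgroup c.G} (hW : W ∈ verticialSubgroups c w)
    (hMW : M ≤ W) :
    ∃ (b' : ℋ.graph.Branch) (q : ℋ.graph.edgeOf b' = e') (h' : ℋ.graph.abuts b' = some w) (k : c.G),
      (∀ y, k * χ y * k⁻¹ = Ψ w (ℋ.brHomAt b' w h' e' q y)) ∧
        W = (Ψ w).toMonoidHom.range.map (MulAut.conj k⁻¹).toMonoidHom := by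
  classical
  have hℋ37 := hℋ.thm37Hypotheses
  obtain ⟨b₁, b₂, w₁, w₂, hb12, q₁, q₂, h₁, h₂⟩ :=
    SemiGraph.exists_branches_of_isClosedEdge (isClosedEdge_of_isGraph hℋ.isGraph e')
  obtain ⟨k₁, hk₁⟩ := exists_conj_comp_brHomAt c h₁ (Ψ w₁) (hΨ w₁) q₁ χ hχ
  obtain ⟨k₂, hk₂⟩ := exists_conj_comp_brHomAt c h₂ (Ψ w₂) (hΨ w₂) q₂ χ hχ
  -- `range χ = kᵢ⁻¹ · Ψ(Π_{bᵢ}) · kᵢ`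
  have hEle : ∀ {b : ℋ.graph.Branch} {u : ℋ.graph.Vertex} (hb : ℋ.graph.abuts b = some u)
      (q : ℋ.graph.edgeOf b = e') (k : c.G),
      (∀ y, k * χ y * k⁻¹ = Ψ u (ℋ.brHomAt b u hb e' q y)) →
        χ.toMonoidHom.range ≤
          ((ℋ.branchSubgroup b u hb).map (Ψ u).toMonoidHom).map (MulAut.conj k⁻¹).toMonoidHom := by
    intro b u hb q k hk
    rintro _ ⟨y, rfl⟩
    refine ⟨Ψ u (ℋ.brHomAt b u hb e' q y), ⟨_, brHomAt_mem_branchSubgroup hb q y, rfl⟩, ?_⟩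
    have hy : χ y = k⁻¹ * Ψ u (ℋ.brHomAt b u hb e' q y) * k⁻¹⁻¹ := by
      rw [← hk y]; group
    rw [MulEquiv.coe_toMonoidHom, MulAut.conj_apply, ContinuousMonoidHom.coe_toMonoidHom]
    exact hy.symm
  have hE₁ := hEle h₁ q₁ k₁ hk₁
  have hE₂ := hEle h₂ q₂ k₂ hk₂
  have hH₁ : (Ψ w₁).toMonoidHom.range.map (MulAut.conj k₁⁻¹).toMonoidHom ∈ verticialSubgroups c w₁ :=
    conj_mem_verticialSubgroups c (range_mem_verticialSubgroups c (Ψ w₁) (hΨ w₁)) k₁⁻¹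
  have hH₂ : (Ψ w₂).toMonoidHom.range.map (MulAut.conj k₂⁻¹).toMonoidHom ∈ verticialSubgroups c w₂ :=
    conj_mem_verticialSubgroups c (range_mem_verticialSubgroups c (Ψ w₂) (hΨ w₂)) k₂⁻¹
  have hEH₁ : χ.toMonoidHom.range ≤ (Ψ w₁).toMonoidHom.range.map (MulAut.conj k₁⁻¹).toMonoidHom :=
    hE₁.trans (Subgroup.map_mono (Subgroup.map_le_range _ _))
  have hEH₂ : χ.toMonoidHom.range ≤ (Ψ w₂).toMonoidHom.range.map (MulAut.conj k₂⁻¹).toMonoidHom :=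
    hE₂.trans (Subgroup.map_mono (Subgroup.map_le_range _ _))
  have hEne : χ.toMonoidHom.range ≠ ⊥ := fun h0 => hMne (le_bot_iff.mp (h0 ▸ hME))
  -- the two hosts are distinct (total estrangement, via `branch_eq_of_hosts_eq`)
  have hne : (Ψ w₁).toMonoidHom.range.map (MulAut.conj k₁⁻¹).toMonoidHom ≠
      (Ψ w₂).toMonoidHom.range.map (MulAut.conj k₂⁻¹).toMonoidHom := fun hEq =>
    hb12 (branch_eq_of_hosts_eq h37ii h37i hℋ37 c Ψ hΨ hEne h₁ h₂ k₁⁻¹ k₂⁻¹ hE₁ hE₂ hEq)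
  -- Thm 3.7 (iii): `M` has exactly these two hosts
  obtain ⟨honly, -⟩ := (h37iii ℋ hℋ37 c M hMc).2 hMne w₁ w₂ _ _ hH₁ hH₂ hne
    (hME.trans hEH₁) (hME.trans hEH₂)
  rcases honly w W hW hMW with hW₁ | hW₂
  · have hw : w = w₁ := by
      by_contra hne'
      have h0 := (h37ii ℋ hℋ37 c).1 w w₁ W _ hW hH₁ hne'
      rw [hW₁, Subgroup.relIndex_self] at h0
      exact one_ne_zero h0
    subst hw
    exact ⟨b₁, q₁, h₁, k₁, hk₁, hW₁⟩
  · have hw : w = w₂ := by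
      by_contra hne'
      have h0 := (h37ii ℋ hℋ37 c).1 w w₂ W _ hW hH₂ hne'
      rw [hW₂, Subgroup.relIndex_self] at h0
      exact one_ne_zero h0
    subst hw
    exact ⟨b₂, q₂, h₂, k₂, hk₂, hW₂⟩

/-- Composition of two conjugations. [folklore] -/
private theorem conj_toMonoidHom_comp {G : Type*} [Group G] (x y : G) :
    (MulAut.conj x).toMonoidHom.comp (MulAut.conj y).toMonoidHom = (MulAut.conj (x * y)).toMonoidHom := by
  ext z; simp [mul_assoc]

/-- **Compatibility at a branch** ([SemiAnbd] Cor. 3.9, proof, p. 268 «induces … compatible with the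
`b_*` up to inner automorphism»): given the lifts `hV : Π_v → Π_w` (through the verticial `χ_v` at
`w`) and `hE : Π_e → Π_{e'}` (through the edge homomorphism `χ_E` at `e'`) of `φ ∘ ψ_v`, `φ ∘ ψ_E`, and
`a` with `ψ_v ∘ b_* = γ_a ∘ ψ_E`, there is a branch `b'` of `e'` abutting to `w` and `γ ∈ Π_w` with
`hV ∘ b_* = γ_γ ∘ b'_* ∘ hE`; moreover the host `(φ a)⁻¹·χ_v(Π_w)·(φ a)` of the image of the edge group
is the host of `range χ_E` through `b'`. [cite: MochizukiSemiAnbd2006, Cor 3.9 p.43] -/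
theorem exists_target_branch_comm (h37i : VerticialInjective.{u}) (h37ii : VerticialDistinct.{u})
    (h37iii : CompactInVerticial.{u}) (hℋ : Cor39Hypotheses ℋ)
    (c𝒢 : TemperedPiChart 𝒢) (cℋ : TemperedPiChart ℋ) (φ : c𝒢.G →ₜ* cℋ.G)
    (Ψ : ∀ w : ℋ.graph.Vertex, ℋ.Gv w →ₜ* cℋ.G) (hΨ : ∀ w, IsVerticialHom cℋ w (Ψ w))
    {v : 𝒢.graph.Vertex} (ψv : 𝒢.Gv v →ₜ* c𝒢.G)
    {w : ℋ.graph.Vertex} (χv : ℋ.Gv w →ₜ* cℋ.G) (hχv : IsVerticialHom cℋ w χv)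
    (hVv : 𝒢.Gv v →ₜ* ℋ.Gv w) (hhV : ∀ y, χv (hVv y) = φ (ψv y))
    {b : 𝒢.graph.Branch} (hb : 𝒢.graph.abuts b = some v)
    (ψE : 𝒢.Ge (𝒢.graph.edgeOf b) →ₜ* c𝒢.G) (a : c𝒢.G)
    (ha : ∀ x, a * ψE x * a⁻¹ = ψv (𝒢.brHom b v hb x))
    {e' : ℋ.graph.Edge} (χE : ℋ.Ge e' →ₜ* cℋ.G) (hχE : IsEdgeHom cℋ e' χE)
    (hEe : 𝒢.Ge (𝒢.graph.edgeOf b) →ₜ* ℋ.Ge e') (hhE : ∀ x, χE (hEe x) = φ (ψE x))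
    (hmaps : MapsOntoOpenSubgroupOf φ.toMonoidHom ψE.toMonoidHom.range χE.toMonoidHom.range) :
    ∃ (b' : ℋ.graph.Branch) (q : ℋ.graph.edgeOf b' = e') (h' : ℋ.graph.abuts b' = some w)
      (k : cℋ.G) (γ : ℋ.Gv w),
      (∀ y, k * χE y * k⁻¹ = Ψ w (ℋ.brHomAt b' w h' e' q y)) ∧
      χv.toMonoidHom.range.map (MulAut.conj (φ a)⁻¹).toMonoidHom =
        (Ψ w).toMonoidHom.range.map (MulAut.conj k⁻¹).toMonoidHom ∧
      ∀ x, hVv (𝒢.brHom b v hb x) = γ * ℋ.brHomAt b' w h' e' q (hEe x) * γ⁻¹ := by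
  classical
  haveI := TemperedPiChart.t2Space cℋ
  have hℋ37 := hℋ.thm37Hypotheses
  -- the image `M` of the edge group
  set M : Subgroup cℋ.G := ψE.toMonoidHom.range.map φ.toMonoidHom with hMdef
  have hME : M ≤ χE.toMonoidHom.range := hmaps.1
  have hMc : IsCompact (M : Set cℋ.G) := by
    have : (M : Set cℋ.G) = Set.range (fun x => φ (ψE x)) := by
      ext z
      simp only [hMdef, Subgroup.coe_map, MonoidHom.coe_range, Set.mem_image, Set.mem_range,
        exists_exists_eq_and]
      rfl
    rw [this]
    exact isCompact_range (φ.continuous.comp ψE.continuous)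
  have hEmem : χE.toMonoidHom.range ∈ edgeLikeSubgroups cℋ e' := ⟨χE, hχE, rfl⟩
  have hMne : M ≠ ⊥ := by
    intro h0
    have h1 := relIndex_ne_zero_of_mapsOnto φ.toMonoidHom (isCompact_of_mem_edgeLikeSubgroups cℋ hEmem) hmaps
    rw [← hMdef, h0, Subgroup.relIndex_bot_left] at h1
    haveI := infinite_of_mem_edgeLikeSubgroups h37i hℋ37 cℋ hEmem
    exact h1 Nat.card_eq_zero_of_infinite
  -- `M` lies in the verticial `(φ a)⁻¹ · χv(Π_w) · (φ a)`
  have hW : χv.toMonoidHom.range.map (MulAut.conj (φ a)⁻¹).toMonoidHom ∈ verticialSubgroups cℋ w :=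
    conj_mem_verticialSubgroups cℋ (range_mem_verticialSubgroups cℋ χv hχv) _
  have hMW : M ≤ χv.toMonoidHom.range.map (MulAut.conj (φ a)⁻¹).toMonoidHom := by
    rintro _ ⟨_, ⟨x, rfl⟩, rfl⟩
    refine ⟨φ a * φ (ψE x) * (φ a)⁻¹, ⟨hVv (𝒢.brHom b v hb x), ?_⟩, ?_⟩
    · show χv (hVv (𝒢.brHom b v hb x)) = _
      rw [hhV, ← ha, map_mul, map_mul, map_inv]
    · show (φ a)⁻¹ * (φ a * φ (ψE x) * (φ a)⁻¹) * (φ a)⁻¹⁻¹ = φ (ψE x)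
      group
  obtain ⟨b', q, h', k, hk, hhost⟩ :=
    exists_branch_of_host h37i h37ii h37iii hℋ cℋ Ψ hΨ χE hχE hME hMc hMne hW hMW
  -- `χv = γ_d ∘ Ψ_w`
  obtain ⟨d, hd⟩ := exists_conj_of_isVerticialHom cℋ (Ψ w) χv (hΨ w) hχv
  have hrange : χv.toMonoidHom.range = (Ψ w).toMonoidHom.range.map (MulAut.conj d).toMonoidHom :=
    range_eq_map_conj_of_conj_eq cℋ (Ψ w) χv d hd
  -- commensurable terminality: `d⁻¹ (φ a) k⁻¹ ∈ Ψ_w(Π_w)`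
  have hmem : ((φ a)⁻¹ * d)⁻¹ * k⁻¹ ∈ (Ψ w).toMonoidHom.range := by
    by_contra hn
    have h0 := (h37ii ℋ hℋ37 cℋ).2 w _ (range_mem_verticialSubgroups cℋ (Ψ w) (hΨ w)) _ _ hn
    have heq : (Ψ w).toMonoidHom.range.map (MulAut.conj ((φ a)⁻¹ * d)).toMonoidHom =
        (Ψ w).toMonoidHom.range.map (MulAut.conj k⁻¹).toMonoidHom := by
      rw [← conj_toMonoidHom_comp, ← Subgroup.map_map, ← hrange, hhost]
    rw [heq, Subgroup.relIndex_self] at h0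
    exact one_ne_zero h0
  obtain ⟨p, hp⟩ := hmem
  have hp' : Ψ w p = d⁻¹ * φ a * k⁻¹ := by
    rw [show Ψ w p = (Ψ w).toMonoidHom p from rfl, hp]; group
  have hinj : Function.Injective χv := (h37i ℋ hℋ37 cℋ w).2 χv hχv
  refine ⟨b', q, h', k, p, hk, hhost, fun x => hinj ?_⟩
  rw [hhV, ← ha, map_mul, map_mul, map_inv, ← hhE, map_mul, map_mul, map_inv, ← hd p, hp',
    ← hd (ℋ.brHomAt b' w h' e' q (hEe x)), ← hk]
  group

end ProfiniteSemiGraph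

end Literature.AnabelianGeometry.SemiGraphs
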